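import Summits.CriticalPhenomena.PercolationContinuityZ3.Theorems.PercNearOneGluingAdditiveGluingCSHHpart
import Summits.CriticalPhenomena.PercolationContinuityZ3.Theorems.PercNearOneGluingAdditiveGluingSetObserverPeel
import HarnessLib

/-!
# Conjecture G / SET-W via a SET observer, III: (K6-set) — the set four-point covariance transfer for an observer SET

Support file (`--supports stmt-CriticalPhenomena-4576`); no definitions, no named facts, no sorries.  Seat (b) V⁺-form `png-dp-vplus`, gen 12
(memo MEMO-gen12.md §4(d) of run/shared/lean/prim/prim-png-dp-vplus/).

The set-observer conditioned slack hierarchy (memo §3) replaces the observer `o` of prim-hp-8's CSH by a vertex SET `O` seen through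
`{O ~ u} := ⋃_{o∈O}{o ↔ u}` with the rule "the observer is killed when it touches the avoided set".  Its level-0 / H-part input is the
set version of (K6) (`CSH.covTransfer_relaySet_edge`, point observer):
* `covTransfer_relaySet_edge_set`: for `x ∈ S`, `g` monotone nonnegative on edge sets, `m = ∫ g(C_x)`, `D = {v ↮ S}`,
  `E = {O ~ v} ∩ {O ≁ S}` (`⊆ D`):   `μ(E)·(∫_{v↔S} g(C_x) − μ(v↔S)·m) ≤ μ(D)·(∫_{O~S} g(C_x) − μ(O~S)·m)`,
  i.e. `Cov(g(C_x), 1{O~S}) ≥ μ(O~v, O≁S | v↮S)·Cov(g(C_x), 1{v↔S})` — the world constant of the set hierarchy.  Proof = the point proof with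
  vdBHK Thm 1.4 replaced by the two-SET theorem (`BHK2006_twoSetConditionalAssociation` for the pair `({v}, S)`): `{O~S∪{v}} = {O~S} ⊔ E`,
  Harris on the union, and on `D` the indicator of `E` is increasing in `C_v`, decreasing in `C_S`, while `g(C_x)` is increasing in `C_S`.
  (gen 10's SET-4PT, 0/63k; the naive constant `μ(O~v | v↮S)` is false, ttrl/own census.)
[cite: VandenbergHaggstromKahn2005, Thm. 2.1 (p. 9) at q = 1, Remark 1 after Thm. 1.2 (p. 5)] [cite: KozmaNitzan2024, Conj. 4 (p. 32)]
-/

noncomputable section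

namespace Summit.CriticalPhenomena.PercolationContinuityZ3.Theorems

open MeasureTheory Set Literature.Probability.LatticeModels Literature.Probability.Percolation
open Literature.Probability.Percolation.KNPreFKG
open Literature.Probability.Percolation.BHK2006 (openEdgeCluster_mono)
open scoped Classical

namespace SetSurplus

variable {V : Type*} [Fintype V]

/-- **(K6-set) — covariance transfer across a set, for an observer SET.**  For `x ∈ S`, `g` monotone nonnegative on edge sets,
`m = ∫ g(C_x)`, `D = {v ↮ S}`, `E = {O~v} ∩ {O≁S}`:
`μ(E)·(∫_{v ↔ S} g(C_x) − μ(v ↔ S)·m) ≤ μ(D)·(∫_{O ~ S} g(C_x) − μ(O ~ S)·m)`.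
[cite: VandenbergHaggstromKahn2005, Thm. 2.1 (p. 9) at q = 1 with Remark 1 (p. 5)] -/
theorem covTransfer_relaySet_edge_set (w : Sym2 V → unitInterval) (S O : Finset V) (v x : V) (hxS : x ∈ S)
    (g : Set (Sym2 V) → ℝ) (hg : Monotone g) (hg0 : ∀ C, 0 ≤ g C) :
    (prodBernoulli w).real ({ω : BondConfig V | ∃ o ∈ O, (openGraph ω).Reachable o v} ∩
        {ω | ∀ o ∈ O, ∀ t ∈ S, ¬ (openGraph ω).Reachable o t}) *
        (∫ ω in (⋃ t ∈ S, openConn v t), g (openEdgeCluster ω x) ∂(prodBernoulli w) -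
          (prodBernoulli w).real (⋃ t ∈ S, openConn v t) * ∫ ω, g (openEdgeCluster ω x) ∂(prodBernoulli w)) ≤
      (prodBernoulli w).real {ω : BondConfig V | ∀ t ∈ S, ¬ (openGraph ω).Reachable v t} *
        (∫ ω in {ω : BondConfig V | ∃ o ∈ O, ∃ t ∈ S, (openGraph ω).Reachable o t}, g (openEdgeCluster ω x) ∂(prodBernoulli w) -
          (prodBernoulli w).real {ω : BondConfig V | ∃ o ∈ O, ∃ t ∈ S, (openGraph ω).Reachable o t} *
            ∫ ω, g (openEdgeCluster ω x) ∂(prodBernoulli w)) := by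
  set μ := prodBernoulli w with hμ
  set f : BondConfig V → ℝ := fun ω => g (openEdgeCluster ω x) with hf
  set m : ℝ := ∫ ω, f ω ∂μ with hm
  have hmeas : ∀ T : Set (BondConfig V), MeasurableSet T := fun _ => MeasurableSet.of_discrete
  have hint : ∀ (k : BondConfig V → ℝ) (T : Set (BondConfig V)), IntegrableOn k T μ :=
    fun k T => (Integrable.of_finite).integrableOn
  have hn := fun (T : Set (BondConfig V)) => (measureReal_nonneg : 0 ≤ μ.real T)
  set D : Set (BondConfig V) := {ω | ∀ t ∈ S, ¬ (openGraph ω).Reachable v t} with hD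
  set OT : Set (BondConfig V) := {ω : BondConfig V | ∃ o ∈ O, ∃ t ∈ S, (openGraph ω).Reachable o t} with hOT
  set E : Set (BondConfig V) := {ω : BondConfig V | ∃ o ∈ O, (openGraph ω).Reachable o v} ∩
    {ω | ∀ o ∈ O, ∀ t ∈ S, ¬ (openGraph ω).Reachable o t} with hE
  set Q : Set (BondConfig V) := ⋃ t ∈ S, openConn v t with hQ
  set U : Set (BondConfig V) := OT ∪ {ω : BondConfig V | ∃ o ∈ O, (openGraph ω).Reachable o v} with hU
  have hED : E ⊆ D := by
    rintro ω ⟨⟨o, ho, hov⟩, h2⟩ t ht hvt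
    exact h2 o ho t ht (hov.trans hvt)
  -- (1) Harris on `U = {O ~ S ∪ {v}}`
  have hupT : IsUpperSet OT := by
    intro ω ω' hle ⟨o, ho, t, ht, h⟩
    exact ⟨o, ho, t, ht, h.mono (openGraph_mono hle)⟩
  have hupV : IsUpperSet {ω : BondConfig V | ∃ o ∈ O, (openGraph ω).Reachable o v} := by
    intro ω ω' hle ⟨o, ho, h⟩
    exact ⟨o, ho, h.mono (openGraph_mono hle)⟩
  have hHarris : μ.real U * m ≤ ∫ ω in U, f ω ∂μ := CSH.setIntegral_edgeFun_ge w x g hg hg0 U (hupT.union hupV)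
  -- (2) two-set BHK for the pair `({v}, S)`: `1_E` is of type (+), `g(C_x)` is increasing in `C_S`
  set G : Set (Sym2 V) → Set (Sym2 V) → ℝ := fun C E' =>
    if (∃ o ∈ O, o = v ∨ ∃ e ∈ C, o ∈ e) ∧ (∀ o ∈ O, ¬ (o ∈ S ∨ ∃ e ∈ E', o ∈ e)) then 1 else 0 with hG
  have hGm : ∀ E', Monotone fun C => G C E' := by
    intro E' C C' hCC'
    simp only [hG]
    by_cases h : (∃ o ∈ O, o = v ∨ ∃ e ∈ C, o ∈ e) ∧ (∀ o ∈ O, ¬ (o ∈ S ∨ ∃ e ∈ E', o ∈ e))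
    · rw [if_pos h, if_pos ⟨h.1.imp fun o ho => ⟨ho.1, ho.2.imp id fun ⟨e, he, hoe⟩ => ⟨e, hCC' he, hoe⟩⟩, h.2⟩]
    · rw [if_neg h]; split_ifs <;> norm_num
  have hGa : ∀ C, Antitone fun E' => G C E' := by
    intro C E₁ E₂ hEE
    simp only [hG]
    by_cases h : (∃ o ∈ O, o = v ∨ ∃ e ∈ C, o ∈ e) ∧ (∀ o ∈ O, ¬ (o ∈ S ∨ ∃ e ∈ E₂, o ∈ e))
    · rw [if_pos h, if_pos ⟨h.1, fun o ho h' => h.2 o ho (h'.imp id fun ⟨e, he, hoe⟩ => ⟨e, hEE he, hoe⟩)⟩]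
    · rw [if_neg h]; split_ifs <;> norm_num
  set Fg : Set (Sym2 V) → Set (Sym2 V) → ℝ := fun _ E' => - g (openEdgeCluster E' x) with hFg
  have hFgm : ∀ E', Monotone fun C => Fg C E' := fun E' => monotone_const
  have hFga : ∀ C, Antitone fun E' => Fg C E' := fun C E₁ E₂ hEE => neg_le_neg (hg (openEdgeCluster_mono hEE x))
  have key := BHK2006_twoSetConditionalAssociation w ({v} : Set V) (↑S : Set V) G Fg hGm hGa hFgm hFga
  have hDset : {ω : BondConfig V | ∀ s ∈ ({v} : Set V), ∀ t ∈ (↑S : Set V), ¬ (openGraph ω).Reachable s t} = D := by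
    ext ω; simp [hD]
  have eG : ∀ ω : BondConfig V, G (⋃ s ∈ ({v} : Set V), openEdgeCluster ω s) (⋃ t ∈ (↑S : Set V), openEdgeCluster ω t) =
      E.indicator (1 : BondConfig V → ℝ) ω := by
    intro ω
    simp only [hG, biUnion_singleton]
    have e1 : (∃ o ∈ O, o = v ∨ ∃ e ∈ openEdgeCluster ω v, o ∈ e) ↔ ∃ o ∈ O, (openGraph ω).Reachable o v := by
      constructor
      · rintro ⟨o, ho, h⟩; exact ⟨o, ho, ((reachable_iff_exists_mem_openEdgeCluster ω v o).2 h).symm⟩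
      · rintro ⟨o, ho, h⟩; exact ⟨o, ho, (reachable_iff_exists_mem_openEdgeCluster ω v o).1 h.symm⟩
    have e2 : (∀ o ∈ O, ¬ (o ∈ S ∨ ∃ e ∈ (⋃ t ∈ (↑S : Set V), openEdgeCluster ω t), o ∈ e)) ↔
        ∀ o ∈ O, ∀ t ∈ S, ¬ (openGraph ω).Reachable o t := by
      refine forall₂_congr fun o _ => ?_
      have h3 : (∃ t ∈ S, (openGraph ω).Reachable o t) ↔ (o ∈ S ∨ ∃ e ∈ (⋃ t ∈ (↑S : Set V), openEdgeCluster ω t), o ∈ e) := by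
        constructor
        · rintro ⟨t, ht, hot⟩
          rcases (reachable_iff_exists_mem_openEdgeCluster ω t o).1 hot.symm with h | ⟨e, he, hoe⟩
          · exact Or.inl (h ▸ ht)
          · exact Or.inr ⟨e, mem_iUnion₂.2 ⟨t, Finset.mem_coe.2 ht, he⟩, hoe⟩
        · rintro (h | ⟨e, he, hoe⟩)
          · exact ⟨o, h, SimpleGraph.Reachable.refl _⟩
          · obtain ⟨t, ht, het⟩ := mem_iUnion₂.1 he
            exact ⟨t, Finset.mem_coe.1 ht, ((reachable_iff_exists_mem_openEdgeCluster ω t o).2 (Or.inr ⟨e, het, hoe⟩)).symm⟩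
      rw [← h3]; simp only [not_exists, not_and]
    by_cases hω : ω ∈ E
    · rw [indicator_of_mem hω, Pi.one_apply, if_pos (⟨e1.2 hω.1, e2.2 hω.2⟩)]
    · rw [indicator_of_notMem hω, if_neg (fun h => hω ⟨e1.1 h.1, e2.1 h.2⟩)]
  have eFg : ∀ ω : BondConfig V, Fg (⋃ s ∈ ({v} : Set V), openEdgeCluster ω s) (⋃ t ∈ (↑S : Set V), openEdgeCluster ω t) = - f ω := by
    intro ω; simp only [hFg, hf]; rw [CovTauStarN.openEdgeCluster_biUnion_eq (Finset.mem_coe.2 hxS)]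
  have i2 : ∫ ω in D, G (⋃ s ∈ ({v} : Set V), openEdgeCluster ω s) (⋃ t ∈ (↑S : Set V), openEdgeCluster ω t) ∂μ = μ.real E := by
    rw [setIntegral_congr_fun (hmeas _) fun ω _ => eG ω, setIntegral_indicator_one_eq, inter_eq_self_of_subset_right hED]
  have i4 : ∫ ω in D, Fg (⋃ s ∈ ({v} : Set V), openEdgeCluster ω s) (⋃ t ∈ (↑S : Set V), openEdgeCluster ω t) ∂μ = - ∫ ω in D, f ω ∂μ := by
    rw [setIntegral_congr_fun (hmeas _) fun ω _ => eFg ω, integral_neg]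
  have i5 : ∫ ω in D, G (⋃ s ∈ ({v} : Set V), openEdgeCluster ω s) (⋃ t ∈ (↑S : Set V), openEdgeCluster ω t) *
        Fg (⋃ s ∈ ({v} : Set V), openEdgeCluster ω s) (⋃ t ∈ (↑S : Set V), openEdgeCluster ω t) ∂μ = - ∫ ω in E, f ω ∂μ := by
    rw [setIntegral_congr_fun (hmeas _) fun ω _ => by rw [eFg ω, eG ω, mul_comm, neg_mul], integral_neg,
      setIntegral_mul_indicator_one, inter_eq_self_of_subset_right hED]
  rw [hDset, i2, i4, i5] at key
  -- key : μ.real E * -∫_D f ≤ μ.real D * -∫_E f, i.e. μ(D)·∫_E f ≤ μ(E)·∫_D f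
  have hBHK : μ.real D * ∫ ω in E, f ω ∂μ ≤ μ.real E * ∫ ω in D, f ω ∂μ := by linarith [key]
  -- (3) `U = OT ⊔ E`
  have hUdiff : U \ OT = E := by
    ext ω
    simp only [hU, hOT, hE, mem_sdiff, mem_union, mem_inter_iff, mem_setOf_eq, not_exists, not_and]
    constructor
    · rintro ⟨h | h, hno⟩
      · obtain ⟨o, ho, t, ht, h'⟩ := h; exact absurd h' (hno o ho t ht)
      · exact ⟨h, hno⟩
    · rintro ⟨hov, hd⟩
      exact ⟨Or.inr hov, hd⟩
  have hUint : ∫ ω in U, f ω ∂μ = ∫ ω in OT, f ω ∂μ + ∫ ω in E, f ω ∂μ := by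
    rw [← integral_inter_add_sdiff (hmeas OT) (hint f U), inter_eq_right.2 subset_union_left, hUdiff]
  have hUμ : μ.real U = μ.real OT + μ.real E := by
    rw [← measureReal_inter_add_sdiff (s := U) (h := measure_ne_top _ _) (hmeas OT), inter_eq_right.2 subset_union_left, hUdiff]
  -- (4) `D = Qᶜ`
  have hDQ : D = Qᶜ := by
    ext ω
    simp [hD, hQ, openConn]
  have hDint : ∫ ω in D, f ω ∂μ = m - ∫ ω in Q, f ω ∂μ := by
    have := integral_add_compl (hmeas Q) (Integrable.of_finite (f := f) (μ := μ))
    rw [← hDQ] at this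
    linarith
  have hDμ : μ.real D = 1 - μ.real Q := by
    have h1 : μ.real (univ : Set (BondConfig V)) = μ.real (univ ∩ Q) + μ.real (univ \ Q) :=
      (measureReal_inter_add_sdiff (s := univ) (h := measure_ne_top _ _) (hmeas Q)).symm
    rw [probReal_univ, univ_inter, ← compl_eq_univ_sdiff, ← hDQ] at h1
    linarith
  -- assemble
  have hA : ∫ ω in OT, f ω ∂μ - μ.real OT * m ≥ μ.real E * m - ∫ ω in E, f ω ∂μ := by
    rw [hUint, hUμ] at hHarris
    linarith
  have hB : μ.real D * (μ.real E * m - ∫ ω in E, f ω ∂μ) ≥ μ.real D * (μ.real E * m) - μ.real E * ∫ ω in D, f ω ∂μ := by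
    rw [mul_sub]
    linarith [hBHK]
  have hC := mul_le_mul_of_nonneg_left hA (hn D)
  rw [hDint, hDμ] at hB
  rw [hDμ] at hC ⊢
  nlinarith [hB, hC, hn E, hn Q]

end SetSurplus

end Summit.CriticalPhenomena.PercolationContinuityZ3.Theorems

end
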